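import Summits.ResolutionOfSingularities.ResolutionOfSingularities.Theorems.EquisingularLiftEquisingularLiftNatNoseTowerRootOfModel
import Summits.ResolutionOfSingularities.ResolutionOfSingularities.Theorems.EquisingularLiftEquisingularLiftNatCentreCodimTwoAdapters
import Summits.ResolutionOfSingularities.ResolutionOfSingularities.Theorems.EquisingularLiftEquisingularLiftNatRationalCarrierLift
import Summits.ResolutionOfSingularities.ResolutionOfSingularities.Theorems.EquisingularLiftEquisingularLiftNatTowerRootsDischarge
import Summits.ResolutionOfSingularities.ResolutionOfSingularities.Theorems.EquisingularLiftEquisingularLiftNatTowerConeRoundOld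
import Summits.ResolutionOfSingularities.ResolutionOfSingularities.Theorems.EquisingularLiftEquisingularLiftNatTowerConeRoundDense
import Summits.ResolutionOfSingularities.ResolutionOfSingularities.Theorems.EquisingularLiftEquisingularLiftNatTowerPtRegInvTwo
import Summits.ResolutionOfSingularities.ResolutionOfSingularities.Theorems.EquisingularLiftEquisingularLiftNatTowerPtRamInvTwo
import Summits.ResolutionOfSingularities.ResolutionOfSingularities.Theorems.EquisingularLiftEquisingularLiftNatTowerRuledPointSteps
import Summits.ResolutionOfSingularities.ResolutionOfSingularities.Theorems.EquisingularLiftEquisingularLiftNatTowerSideFacts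
import Summits.ResolutionOfSingularities.ResolutionOfSingularities.Theorems.EquisingularLiftEquisingularLiftNatTowerRoundThreeDefs
import Summits.ResolutionOfSingularities.ResolutionOfSingularities.Theorems.EquisingularLiftEquisingularLiftNatCarrierCurveDimension
import HarnessLib

/-!
# [OURS · L1 W4.5(b) · EL♮(3)] HSUB′ v2 (ReachNoseTower₄) — THE NOSE ASSEMBLY V4: `hsub_reachNoseTowerV4_four_of` (input (c) DERIVED — no frame stand-in)
# (crux `EquisingularLiftNatThree` = stmt-ResolutionOfSingularities-20148, parent stmt-…-20038; rung NOSE-TOWER₄, registered stub `stub_elnat_ratNoseTowerResolution`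
# @ `ReachNoseTower₄` (TARGET-RATNOSETOWER4 5929f9f170217c9c); closer `stub_elnat_ratNoseTowerResolution_of_hsub₄` (res-D-pv-018 p569943);
# res-L1-w45b-plan-1 RULING-8 (α) «all rounds along sections», RULING 20:45:53Z (HSUB′ v2), desk word 21:05:10Z «v2.1 follow-ups»)

res-D-pv-018 g5 (KEPT D hand for the nose). OURS; NOT a statement of any manuscript; AI-written, weaker than expert review. No `sorry`; standard axioms.
DEF-FREE. `--supports stmt-ResolutionOfSingularities-20148 --as helper`. Successor of …NatNoseTowerAssemblyV2 (p571116: stand-ins S2/S5/S6 + `hTj`): at revision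
₄ every round — Čech or cone — comes WITH a section (`hsec : DirStepSec …` hoisted in `TowerRound₃`, …NatTowerRoundThreeDefs p567373), so
* S2 `hRootRound` is DISCHARGED by res-L1-w45b-stub-4's `Tower.inv₂_coneRound_new_sec` (…NatTowerRootsDischarge p570221: `DirLift.ruled_coneRound_root_of_dirStepSec`
  + `rationalCarrier_of_dirStepSec`, modulo the 2-frame input `hFrame` and the residue `hTj`);
* S5 `hDense` is DISCHARGED by res-D-pv-029's `Tower.subset_closure_diff_of_inv₂_coneWitness` (…NatTowerConeRoundDense p565951);
* the (seed) is res-D-pv-035's N1′ `Tower.inv₂_noseSeed_root_of_dimZ'` (p570035) fed by `hdimZ_of_iso_projectiveLine j Z hZ hZP1` (res-L1-w45b-stub-3 p570070)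
  and `hTj.hCrat_of_isProper` (res-L1-type-o6 p568626) — the nose root discharged as in V2;
* (pt-reg)/(pt-ram) and the cone-round side facts are res-D-pv-029's `TowerAssembly.lean` blocks VERBATIM (bricks `Tower.towerPtReg₂_inv₂` p562007,
  `Tower.towerPtRam₂_inv₂`, `DirLift.ruled_of_step_away`, `Tower.inv₂_coneRound_old` p560701, `DirLift.ruled_comp`, …NatTowerSideFacts); (final) := `Tower.inv₂_final`.
No driver is needed at ₄: the proof runs the closure premise at `R₁ := INV₁ F₁ Z hZ F₂ υ` (res-D-pv-035's driver p564786 inlined in three lines).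
V4 (this file, successor of V3 p571827): V3's stand-in `hFrameAll` was REFUTABLE as universally typed (a relative hyperplane meets its hypotheses with a principal stalk
ideal); here input (c) is DERIVED at the cone rounds by res-L1-w45b-stub-3's `forall_exists_twoFrame_of_model_of_carrier` (…NatCarrierCurveDimension p571497) from
T-DIM, the `DirStepSec` iso and the CARRIER DATUM «`Z̃` has 1-dimensional closed-point stalks», which for the nose is a THEOREM (`hZP1` + stub-3's
`ringKrullDim_stalk_eq_of_iso_projectiveSpace`) threaded through `INV₁` as a constant conjunct.
REMAINING STAND-INS = {S6 `hCech` (res-D-pv-029's binder text VERBATIM; closer `Tower.hCech_of` of res-D-pv-057), `hTj : RationalCarrierLift O k θ P q` (residue (T-j))}.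
-/

set_option linter.dupNamespace false -- mandated namespace `Summit.<Summit>.<Problem>` of this single-conjunct summit
set_option linter.overlappingInstances false -- signatures carry `[IsDomain O] [IsDiscreteValuationRing O]`

noncomputable section

open CategoryTheory CategoryTheory.Limits AlgebraicGeometry TopologicalSpace Topology IsLocalRing
open Literature.AlgebraicGeometry.Resolution
open AlgebraicGeometry.Scheme.IdealSheafData
open Summit.ResolutionOfSingularities.ResolutionOfSingularities.Theses.EquisingularLift.Split
open Summit.ResolutionOfSingularities.ResolutionOfSingularities.Cruxes.EquisingularLift.StrataSplit

namespace Summit.ResolutionOfSingularities.ResolutionOfSingularities.Cruxes.EquisingularLiftNat.Sections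

/-- **HSUB′ v2 (ReachNoseTower₄) at relative dimension 3, revision-₄-native** (see the module docstring): the nose assembly with the root (N1), the
cone-round root (S2), the density fact (S5) and input (c) DISCHARGED; stand-ins S6 `hCech`, residue `hTj`. [cite: GortzWedhorn2020, Prop. 13.91 and (13.19)]
[cite: Liu2002, §8.1 and Thm. 8.1.19] [OURS · L1 W4.5b] toward `stub_elnat_ratNoseTowerResolution` via `stub_elnat_ratNoseTowerResolution_of_hsub₄`; NOT a statement
of the manuscript; AI-written, weaker than expert review. -/
theorem hsub_reachNoseTowerV4_four_of (k : Type) [Field k]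
    (O : Type) [CommRing O] [IsDomain O] [IsDiscreteValuationRing O] [IsAdicComplete (IsLocalRing.maximalIdeal O) O]
    [IsAlgClosed (IsLocalRing.ResidueField O)] (θ : O →+* k) (hθ : Function.Surjective θ)
    (P : Scheme.{0}) (q : P ⟶ Spec (.of O)) (Y : Set P) (Ch : ∀ X' : Scheme.{0}, (X' ⟶ P) → Set X' → Prop)
    (hChStep : ∀ (X' X'' : Scheme.{0}) (σ' : X' ⟶ P) (S' : Set X') (C : X'.IdealSheafData) (τ : X'' ⟶ X'),
      Ch X' σ' S' → IsBlowup τ C → Scheme.IsRegular C.subscheme → Flat (C.subschemeι ≫ σ' ≫ q) →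
      σ' '' (C.support : Set X') ⊆ {y | ¬ IsGenericPoint y Y} → (C.support : Set X') ∩ (σ' ≫ q) ⁻¹' {IsLocalRing.closedPoint O} ⊆ S' →
      Ch X'' (τ ≫ σ') (closure (τ ⁻¹' (S' \ (C.support : Set X')))))
    (hChSplit : ∀ (X' : Scheme.{0}) (σ' : X' ⟶ P) (S' : Set X'), Ch X' σ' S' → Chain P Y X' σ' S')
    (hYsp : Y ⊆ q ⁻¹' {IsLocalRing.closedPoint O}) (hYirr : IsIrreducible Y) (hYcl : IsClosed Y) (hPint : IsIntegral P)
    (hPnoeth : IsLocallyNoetherian P) (hPreg : Scheme.IsRegular P) (hqprop : IsProper q) (hqsm : SmoothOfRelativeDimension 3 q)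
    -- the stage before the nose and its model
    (X' : Scheme.{0}) (σ' : X' ⟶ P) (S' : Set X') (hCh' : Ch X' σ' S') (hX'int : IsIntegral X') (hX'noeth : IsLocallyNoetherian X')
    (hX'reg : Scheme.IsRegular X') (_hX'dom : IsDominant (σ' ≫ q)) (F₁ : Scheme.{0}) (_hF₁ : IsIntegral F₁) (j : F₁ ⟶ X')
    (t : F₁ ⟶ Spec (.of k)) (hsq : IsPullback j t (σ' ≫ q) (Spec.map (CommRingCat.ofHom θ))) (T₁ : Set F₁) (_hT₁cl : IsClosed T₁)
    (_hT₁irr : IsIrreducible T₁) (_hjT₁ : j '' T₁ = S')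
    -- the NOSE block
    (Z : Set F₁) (hZ : IsClosed Z) (_hZT₁ : Z ⊆ T₁) (hT₁Z : ¬ (T₁ ⊆ Z)) (hZinf : Z.Infinite)
    (hZP1 : Nonempty (redSub F₁ Z hZ ≅ (Literature.AlgebraicGeometry.Motives.projectiveSpace 1 k).left))
    (C : X'.IdealSheafData) (_hCsm : Smooth (C.subschemeι ≫ σ' ≫ q)) (hCreg : Scheme.IsRegular C.subscheme) (hCfl : Flat (C.subschemeι ≫ σ' ≫ q))
    (hCj : C.comap j = vanishingIdeal (⟨Z, hZ⟩ : Closeds F₁)) (hCoff : ∀ c ∈ (C.support : Set X'), ¬ IsGenericPoint (σ' c) Y)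
    (X₁ : Scheme.{0}) (τ₁ : X₁ ⟶ X') (hτ₁ : IsBlowup τ₁ C) (hX₁int : IsIntegral X₁) (hX₁noeth : IsLocallyNoetherian X₁)
    (hX₁reg : Scheme.IsRegular X₁) (hX₁dom : IsDominant ((τ₁ ≫ σ') ≫ q)) (F₂ : Scheme.{0}) (hF₂ : IsIntegral F₂) (υ : F₂ ⟶ F₁)
    (hυ : IsBlowup υ (vanishingIdeal (⟨Z, hZ⟩ : Closeds F₁))) (j₂ : F₂ ⟶ X₁) (t₂ : F₂ ⟶ Spec (.of k))
    (hsq₂ : IsPullback j₂ t₂ ((τ₁ ≫ σ') ≫ q) (Spec.map (CommRingCat.ofHom θ))) (hcomm : j₂ ≫ τ₁ = υ ≫ j)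
    (_hexc : (C.comap τ₁).comap j₂ = (vanishingIdeal (⟨Z, hZ⟩ : Closeds F₁)).comap υ)
    (hirr₂ : IsIrreducible (closure (υ ⁻¹' (T₁ \ Z)))) (hCh₁ : Ch X₁ (τ₁ ≫ σ') (j₂ '' closure (υ ⁻¹' (T₁ \ Z))))
    -- ===================== NAMED STAND-INS (shrink as bricks land) =====================
    -- (T-j) residue: the rational-carrier lift at every O-smooth centre of the telescope (res-L1-type-o6 `RationalCarrierLift`, p568626);
    --       feeds N1′'s `hCrat` at the nose root via `RationalCarrierLift.hCrat_of_isProper`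
    (hTj : RationalCarrierLift O k θ P q)
    -- (S6) the Čech-witnessed round (VERBATIM the tower assembly)
    (hCech : ∀ {F₉ : Scheme.{0}} (Z₉ : Set F₉) (hZ₉ : IsClosed Z₉) {F₁₀ : Scheme.{0}} (υ' : F₁₀ ⟶ F₉)
        (G G' : Scheme.{0}) (γ : G ⟶ F₁₀) (T E K : Set G) (hE : IsClosed E) (Z : Set G) (hZ : IsClosed Z) (υ₂ : G' ⟶ G) (K' : Set G'),
        (Tower.Inv₂ O k θ P q Y Ch (DirLift.Ruled O k θ P q Y) F₉ Z₉ hZ₉ F₁₀ υ' G γ T E K ∧ IsClosed K ∧ K ⊆ closure (K \ E) ∧ K ≠ Set.univ) →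
        Z ⊆ E ∩ T → Z.Nonempty → TowerFull F₉ F₁₀ υ' Z₉ hZ₉ G γ Z hZ →
        (DirStepSec F₉ F₁₀ υ' Z₉ hZ₉ G γ Z hZ ∧ RationalCarrier (redSub F₉ Z₉ hZ₉) ∧
          (∀ x : redSub G Z hZ, IsRegularLocalRing (G.presheaf.stalk (redSubι G Z hZ x))) ∧
          (∀ (i : redSub G Z hZ ⟶ redSub G E hE), i ≫ redSubι G E hE = redSubι G Z hZ →
            ∀ x : redSub G Z hZ, IsRegularLocalRing ((redSub G E hE).presheaf.stalk (i x))) ∧ DirStepUnobs G E hE Z hZ) →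
        IsBlowup υ₂ (vanishingIdeal (⟨Z, hZ⟩ : Closeds G)) →
        (K' = ∅ ∨ ((ConeWitness G E hE K Z hZ ∨ closure (Z \ closure K) = Z) ∧ K' = closure (υ₂ ⁻¹' (K \ Z)))) →
        (Tower.Inv₂ O k θ P q Y Ch (DirLift.Ruled O k θ P q Y) F₉ Z₉ hZ₉ F₁₀ υ' G' (υ₂ ≫ γ) (closure (υ₂ ⁻¹' (T \ Z))) (υ₂ ⁻¹' Z) K' ∧
            IsClosed K' ∧ K' ⊆ closure (K' \ υ₂ ⁻¹' Z) ∧ K' ≠ Set.univ) ∧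
          (Tower.Inv₂ O k θ P q Y Ch (DirLift.Ruled O k θ P q Y) F₉ Z₉ hZ₉ F₁₀ υ' G' (υ₂ ≫ γ) (closure (υ₂ ⁻¹' (T \ Z))) (closure (υ₂ ⁻¹' (E \ Z))) K' ∧
            IsClosed K' ∧ K' ⊆ closure (K' \ closure (υ₂ ⁻¹' (E \ Z))) ∧ K' ≠ Set.univ))
    : -- ===================== HSUB′ v2 (ReachNoseTower₄)'s LAST BLOCK (revision ₄: `TowerRound₃`) =====================
    ∀ (F' : Scheme.{0}) (γ' : F' ⟶ F₂) (T' E' K' : Set F'),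
      (∀ R₁ : (∀ G : Scheme.{0}, (G ⟶ F₂) → Set G → Set G → Set G → Prop),
        R₁ F₂ (𝟙 F₂) (closure (υ ⁻¹' (T₁ \ Z))) (υ ⁻¹' Z) ∅ → TowerPtReg₂ F₁ F₂ υ R₁ → TowerPtRam₂ F₁ F₂ υ R₁ →
        TowerRound₃ F₁ F₂ υ Z hZ R₁ → R₁ F' γ' T' E' K') →
      ∃ (X₉ : Scheme.{0}) (σ₉ : X₉ ⟶ P) (S₉ : Set X₉) (j₉ : F' ⟶ X₉) (t₉ : F' ⟶ Spec (.of k)),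
        Ch X₉ σ₉ S₉ ∧ IsIntegral X₉ ∧ IsLocallyNoetherian X₉ ∧ Scheme.IsRegular X₉ ∧ IsDominant (σ₉ ≫ q) ∧
        IsPullback j₉ t₉ (σ₉ ≫ q) (Spec.map (CommRingCat.ofHom θ)) ∧ j₉ '' T' = S₉ ∧ IsClosed T' ∧ IsIrreducible T' ∧ IsIntegral F' := by
  classical
  haveI := hPint
  haveI := hqprop
  haveI := hqsm
  haveI := hX'int
  haveI := hX'noeth
  haveI := hX₁int
  haveI := hX₁noeth
  haveI := hF₂
  -- INV₁ (tower): res-D-pv-029's conjunction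
  let INV₁ : ∀ (F₉ : Scheme.{0}) (Z₉ : Set F₉), IsClosed Z₉ → ∀ (F₁₀ : Scheme.{0}), (F₁₀ ⟶ F₉) →
      ∀ G : Scheme.{0}, (G ⟶ F₁₀) → Set G → Set G → Set G → Prop :=
    fun F₉ Z₉ hZ₉ F₁₀ υ' G γ T E K => (Tower.Inv₂ O k θ P q Y Ch (DirLift.Ruled O k θ P q Y) F₉ Z₉ hZ₉ F₁₀ υ' G γ T E K ∧
      IsClosed K ∧ K ⊆ closure (K \ E) ∧ K ≠ Set.univ) ∧
      (∀ z : ↥(redSub F₉ Z₉ hZ₉), IsClosed ({z} : Set ↥(redSub F₉ Z₉ hZ₉)) →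
        ringKrullDim ((redSub F₉ Z₉ hZ₉).presheaf.stalk z) = ((1 : ℕ) : WithBot ℕ∞))
  -- the nose's carrier datum from `hZP1` (res-L1-w45b-stub-3 `ringKrullDim_stalk_eq_of_iso_projectiveSpace`): NO stand-in for the nose
  have hcar₀ : ∀ z : ↥(redSub F₁ Z hZ), IsClosed ({z} : Set ↥(redSub F₁ Z hZ)) →
      ringKrullDim ((redSub F₁ Z hZ).presheaf.stalk z) = ((1 : ℕ) : WithBot ℕ∞) := by
    obtain ⟨e⟩ := hZP1
    exact fun z hz => ringKrullDim_stalk_eq_of_iso_projectiveSpace 1 e z hz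
  -- input (c) DERIVED: 2-frames of a regular `O`-flat centre on a `Ch`-stage from the carrier datum through a section iso
  -- (res-L1-w45b-stub-3 `forall_exists_twoFrame_of_model_of_carrier` p571497, T-DIM `ringKrullDim_stalk_eq_succ_of_chain`, `chain_isRegular`)
  obtain ⟨ξ, hξ⟩ : ∃ ξ : P, IsGenericPoint ξ Y := QuasiSober.sober hYirr hYcl
  have hFrameOf : ∀ {G : Scheme.{0}} (T : Set G) (Z : Set G) (hZ : IsClosed Z) {C₉ : Scheme.{0}}
      (_ : ∀ c : C₉, IsClosed ({c} : Set C₉) → ringKrullDim (C₉.presheaf.stalk c) = ((1 : ℕ) : WithBot ℕ∞))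
      (δ : redSub G Z hZ ⟶ C₉) [IsIso δ]
      (X : Scheme.{0}) (σ : X ⟶ P) (S : Set X) (jG : G ⟶ X) (tG : G ⟶ Spec (.of k)) (𝒞 : X.IdealSheafData),
      Ch X σ S → IsIntegral X → IsLocallyNoetherian X → Scheme.IsRegular X → IsDominant (σ ≫ q) →
      IsPullback jG tG (σ ≫ q) (Spec.map (CommRingCat.ofHom θ)) → jG '' T = S →
      𝒞.comap jG = vanishingIdeal ⟨Z, hZ⟩ → Flat (𝒞.subschemeι ≫ σ ≫ q) → Scheme.IsRegular 𝒞.subscheme →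
      ∀ x ∈ 𝒞.support, ∃ c : Fin 2 → X.presheaf.stalk x, Ideal.span (Set.range c) = stalkIdeal 𝒞 x ∧ IsQuasiRegular c := by
    intro G T Z hZ C₉ hdimZ₉ δ _ X σ S jG tG 𝒞 hCh _ hXnoeth hXreg _ hsqG _ hCD hCflat hCreg
    haveI := hXnoeth
    haveI : IsProper σ := (chain_isRegular P Y X σ S (hChSplit X σ S hCh) hPnoeth hPreg).2.2
    haveI : IsProper (σ ≫ q) := inferInstance
    haveI : Flat (𝒞.subschemeι ≫ σ ≫ q) := hCflat
    exact forall_exists_twoFrame_of_model_of_carrier O k θ hθ (σ ≫ q) jG tG hsqG hXreg 𝒞 hCreg hCD (n := 3) (d := 1) rfl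
      (fun x _ hxcl hx0 => ringKrullDim_stalk_eq_succ_of_chain q 3 hξ (hChSplit X σ S hCh) hxcl hx0) δ hdimZ₉
  -- (seed): res-D-pv-035's N1′ corollary (nose root discharged under HSUB′ v2: `hZP1` ↦ hdimZ by res-L1-w45b-stub-3's adapter, `hTj` ↦ hCrat by res-L1-type-o6)
  have hseed : INV₁ F₁ Z hZ F₂ υ F₂ (𝟙 F₂) (closure (υ ⁻¹' (T₁ \ Z))) (υ ⁻¹' Z) ∅ := by
    haveI : IsProper σ' := (chain_isRegular P Y X' σ' S' (hChSplit X' σ' S' hCh') hPnoeth hPreg).2.2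
    refine ⟨?_, hcar₀⟩
    exact Tower.inv₂_noseSeed_root_of_dimZ' O k θ hθ P q Y Ch hChSplit hYirr hYcl hPint hPnoeth hPreg hqprop hqsm X' σ' S' hCh' hX'int
      hX'noeth hX'reg F₁ j t hsq T₁ Z hZ hT₁Z hZinf C hCreg hCfl hCj hCoff X₁ τ₁ hτ₁ hX₁int hX₁noeth hX₁reg hX₁dom F₂ hF₂ υ hυ j₂ t₂ hsq₂
      hcomm hirr₂ hCh₁ (show 3 = 1 + 2 from rfl) (hdimZ_of_iso_projectiveLine j Z hZ hZP1) (hTj.hCrat_of_isProper σ' C hsq hCj hCfl hCreg)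
  -- (pt-reg): res-D-pv-029 TowerAssembly.lean block VERBATIM
  have hptreg : ∀ (F₉ : Scheme.{0}) (Z₉ : Set F₉) (hZ₉ : IsClosed Z₉) (F₁₀ : Scheme.{0}) (υ' : F₁₀ ⟶ F₉),
      TowerPtReg₂ F₉ F₁₀ υ' (INV₁ F₉ Z₉ hZ₉ F₁₀ υ') := by
    intro F₉ Z₉ hZ₉ F₁₀ υ' G G' γ T E K y υ₂ hy K' E' hinv hTreg hGreg hυ₂ hK' hE'
    obtain ⟨⟨hinv, hKcl, hKE, hKne⟩, hcar⟩ := hinv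
    have hI₂ := Tower.towerPtReg₂_inv₂ O k θ hθ P q Y hYsp hYirr hYcl hPnoeth hPreg Ch hChSplit hChStep (DirLift.Ruled O k θ P q Y) F₉ Z₉ hZ₉ F₁₀ υ'
      (DirLift.ruled_of_step_away O k θ P q Y F₉ Z₉ hZ₉ F₁₀ υ') G G' γ T E K y υ₂ hy K' E' hinv hTreg hGreg hυ₂ hK' hE'
    refine (fun h3 => ⟨⟨hI₂, h3⟩, hcar⟩) ?_
    obtain ⟨-, -, hGint, -, hTirr, hEcl, hTE, -⟩ := hinv
    obtain ⟨-, -, hG'int, -⟩ := hI₂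
    haveI := hGint
    haveI := hG'int
    have hTy : ¬ T ⊆ {curvePt G T y} := not_subset_singleton_of_not_isRegularLocalRing_stalk y hTreg hy
    have hDsupp : ((vanishingIdeal (⟨{curvePt G T y}, hy⟩ : Closeds G) : G.IdealSheafData).support : Set G) = {curvePt G T y} :=
      Scheme.IdealSheafData.coe_support_vanishingIdeal _
    rcases hK' with rfl | ⟨hyK, rfl⟩
    · exact ⟨isClosed_empty, by simp, Set.empty_ne_univ⟩
    · refine ⟨isClosed_closure, ?_, closure_preimage_ne_univ υ₂ _ hυ₂ K {curvePt G T y} hKcl hKne hy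
        (fun h => hTy (h ▸ Set.subset_univ _)) hDsupp.le _ (Set.preimage_mono fun z hz => hz.1)⟩
      rcases hE' with rfl | ⟨-, rfl⟩
      · exact closure_preimage_diff_subset_closure_diff_preimage υ₂ K {curvePt G T y}
      · have h := closure_preimage_diff_subset_of_isBlowup υ₂ (vanishingIdeal (⟨{curvePt G T y}, hy⟩ : Closeds G)) hυ₂ K E hEcl hKE
        rw [hDsupp] at h
        exact h
  -- (pt-ram): res-D-pv-029 TowerAssembly.lean block VERBATIM
  have hptram : ∀ (F₉ : Scheme.{0}) (Z₉ : Set F₉) (hZ₉ : IsClosed Z₉) (F₁₀ : Scheme.{0}) (υ' : F₁₀ ⟶ F₉),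
      TowerPtRam₂ F₉ F₁₀ υ' (INV₁ F₉ Z₉ hZ₉ F₁₀ υ') := by
    intro F₉ Z₉ hZ₉ F₁₀ υ' G G' γ T E K y J υ₂ K' E' hinv hTreg hGreg hJsupp hJgen hυ₂ hK' hE'
    obtain ⟨⟨hinv, hKcl, hKE, hKne⟩, hcar⟩ := hinv
    have hI₂ := Tower.towerPtRam₂_inv₂ O k θ hθ P q Y hYsp hYirr hYcl hPnoeth hPreg Ch hChSplit hChStep (DirLift.Ruled O k θ P q Y) F₉ Z₉ hZ₉ F₁₀ υ'
      (DirLift.ruled_of_step_away O k θ P q Y F₉ Z₉ hZ₉ F₁₀ υ') G G' γ T E K y J υ₂ K' E' hinv hTreg hGreg hJsupp hJgen hυ₂ hK' hE'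
    refine (fun h3 => ⟨⟨hI₂, h3⟩, hcar⟩) ?_
    obtain ⟨-, -, hGint, -, hTirr, hEcl, hTE, -⟩ := hinv
    obtain ⟨-, -, hG'int, -⟩ := hI₂
    haveI := hGint
    haveI := hG'int
    have hyc : IsClosed ({curvePt G T y} : Set G) := hJsupp ▸ J.support.isClosed
    have hTy : ¬ T ⊆ {curvePt G T y} := not_subset_singleton_of_not_isRegularLocalRing_stalk y hTreg hyc
    rcases hK' with rfl | ⟨hyK, rfl⟩
    · exact ⟨isClosed_empty, by simp, Set.empty_ne_univ⟩
    · refine ⟨isClosed_closure, ?_, closure_preimage_ne_univ υ₂ _ hυ₂ K {curvePt G T y} hKcl hKne hyc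
        (fun h => hTy (h ▸ Set.subset_univ _)) hJsupp.le _ (Set.preimage_mono fun z hz => hz.1)⟩
      rcases hE' with rfl | ⟨-, rfl⟩
      · exact closure_preimage_diff_subset_closure_diff_preimage υ₂ K {curvePt G T y}
      · have h := closure_preimage_diff_subset_of_isBlowup υ₂ J hυ₂ K E hEcl hKE
        rw [hJsupp] at h
        exact h
  -- (round) at revision ₄ (`TowerRound₃`: every round comes WITH a section `hsec`): Čech disjunct ↦ stand-in S6; cone disjunct ↦
  --   res-L1-w45b-stub-4's `Tower.inv₂_coneRound_new_sec` (S2 discharged modulo `hFrameAll`/`hTj`) + res-D-pv-029's `Tower.inv₂_coneRound_old` with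
  --   S5 := `Tower.subset_closure_diff_of_inv₂_coneWitness`; side facts VERBATIM res-D-pv-029's block
  have hround : ∀ (F₉ : Scheme.{0}) (Z₉ : Set F₉) (hZ₉ : IsClosed Z₉) (F₁₀ : Scheme.{0}) (υ' : F₁₀ ⟶ F₉),
      TowerRound₃ F₉ F₁₀ υ' Z₉ hZ₉ (INV₁ F₉ Z₉ hZ₉ F₁₀ υ') := by
    intro F₉ Z₉ hZ₉ F₁₀ υ' G G' γ T E K hE Z hZ υ₂ K' hinv hZET hZne hfull hsec hwit hυ₂ hK'
    rcases hwit with hcech | hcone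
    · have h := hCech Z₉ hZ₉ υ' G G' γ T E K hE Z hZ υ₂ K' hinv.1 hZET hZne hfull ⟨hsec, hcech⟩ hυ₂ hK'
      exact ⟨⟨h.1, hinv.2⟩, ⟨h.2, hinv.2⟩⟩
    · obtain ⟨⟨hinv₂, hKcl, hKE, hKne⟩, hcar⟩ := hinv
      obtain ⟨δ, _, hδiso⟩ := id hsec
      haveI := hδiso
      have hGint : IsIntegral G := hinv₂.2.2.1
      have hEcl : IsClosed E := hinv₂.2.2.2.2.2.1
      have hTE : ¬ T ⊆ E := hinv₂.2.2.2.2.2.2.1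
      haveI := hGint
      have hK'' : K' = ∅ ∨ K' = closure (υ₂ ⁻¹' (K \ Z)) := by
        rcases hK' with h | ⟨-, h⟩
        · exact Or.inl h
        · exact Or.inr h
      have hZE : Z ⊆ E := fun z hz => (hZET hz).1
      have hZsupp : ((vanishingIdeal (⟨Z, hZ⟩ : Closeds G) : G.IdealSheafData).support : Set G) = Z :=
        Scheme.IdealSheafData.coe_support_vanishingIdeal _
      have hnew := Tower.inv₂_coneRound_new_sec O k θ hθ P q Y hYsp hYirr hYcl hPnoeth hPreg Ch hChSplit hChStep Z₉ hZ₉ υ' G G' γ T E K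
        hE Z hZ υ₂ hinv₂ hZET hZne hsec hcone hυ₂ hKcl hKE hKne (fun X σ S jG tG 𝒞 h₁ h₂ h₃ h₄ h₅ h₆ h₇ h₈ h₉ h₁₀ =>
          hFrameOf T Z hZ hcar δ X σ S jG tG 𝒞 h₁ h₂ h₃ h₄ h₅ h₆ h₇ h₈ h₉ h₁₀) hTj K' hK''
      have hold := Tower.inv₂_coneRound_old O k θ hθ P q Y hYirr hYcl hPnoeth hPreg Ch hChSplit hChStep (DirLift.Ruled O k θ P q Y) Z₉ hZ₉ υ' G G' γ T E K
        hE Z hZ υ₂ hinv₂ hZET hZne hfull hcone hυ₂ hKcl hKE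
        (Tower.subset_closure_diff_of_inv₂_coneWitness O k θ hθ P q Y Ch (DirLift.Ruled O k θ P q Y) Z₉ hZ₉ υ' G γ T E K hE Z hZ hinv₂ hfull hZE hcone)
        (fun X σ jG 𝓔 𝒦 X'' τ j₂ t₂ _ _ hcomm _ he h => by
          obtain ⟨e, he⟩ := he
          exact DirLift.ruled_comp h τ υ₂ j₂ hcomm _ e he _) K' hK''
      have hG'int : IsIntegral G' := hnew.2.2.1
      haveI := hG'int
      have hTZ : ¬ T ⊆ Z := fun h => hTE (h.trans hZE)
      rcases hK'' with rfl | rfl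
      · exact ⟨⟨⟨hnew, isClosed_empty, Set.empty_subset _, Set.empty_ne_univ⟩, hcar⟩, ⟨⟨hold, isClosed_empty, Set.empty_subset _,
          Set.empty_ne_univ⟩, hcar⟩⟩
      · have hne : closure (υ₂ ⁻¹' (K \ Z)) ≠ Set.univ :=
          closure_preimage_ne_univ υ₂ _ hυ₂ K Z hKcl hKne hZ (fun h => hTZ (h ▸ Set.subset_univ _)) hZsupp.le _
            (Set.preimage_mono fun z hz => hz.1)
        refine ⟨⟨⟨hnew, isClosed_closure, closure_preimage_diff_subset_closure_diff_preimage υ₂ K Z, hne⟩, hcar⟩,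
          ⟨⟨hold, isClosed_closure, ?_, hne⟩, hcar⟩⟩
        have h := closure_preimage_diff_subset_of_isBlowup υ₂ (vanishingIdeal (⟨Z, hZ⟩ : Closeds G)) hυ₂ K E hEcl hKE
        rw [hZsupp] at h
        exact h
  -- the closure at `R₁ := INV₁ F₁ Z hZ F₂ υ`, then (final) := `Tower.inv₂_final ∘ And.left`
  intro F' γ' T' E' K' hcl
  have h' : INV₁ F₁ Z hZ F₂ υ F' γ' T' E' K' := hcl (INV₁ F₁ Z hZ F₂ υ) hseed (hptreg F₁ Z hZ F₂ υ) (hptram F₁ Z hZ F₂ υ) (hround F₁ Z hZ F₂ υ)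
  exact Tower.inv₂_final O k θ P q Y Ch (DirLift.Ruled O k θ P q Y) F₁ Z hZ F₂ υ F' γ' T' E' K' h'.1.1

end Summit.ResolutionOfSingularities.ResolutionOfSingularities.Cruxes.EquisingularLiftNat.Sections

end
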